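import Summits.Ventures.PercRepro.RankLevelSetBiIndepLR

/-! # RankLevelSetBiIndepLRPerElem — THE PER-ELEMENT REFINEMENT (PE) OF THE LIKELIHOOD-RATIO MONOTONICITY (LR)
(night-1 g27; dossier §39)

For a finite matroid `M`, an element `y ∈ E` and a second element `e ∈ E`, `e ≠ y`, refine the marked profiles of
`RankLevelSetBiIndepLR` by the membership of `e`:
* `yThroughWithCount M y e k = #{Q ∈ D_{k+1} : y ∈ Q, e ∈ Q}` (the through-`y` `(k+1)`-sets that also contain `e`),
* `yAvoidWithCount M y e k = #{Z ∈ D_k : y ∉ Z, e ∈ Z}` (the avoid-`y` `k`-sets that contain `e`).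
**(PE)** (`BiIndepPE M`, a `Prop`, NOT asserted): for every `y`, every `e ≠ y` and all `p < q`,
`#{Q ∈ D_{q+1} : y, e ∈ Q} · b_p ≤ a_p · #{Z ∈ D_q : y ∉ Z, e ∈ Z}` — the `e`-restricted ratio at level `q` is at most
the full ratio `a_p / b_p` at level `p`. Summed over `e ∈ E ∖ {y}` (double counting: `Σ_e #{Z ∋ e} = q · b_q` and
`Σ_{e ≠ y} #{Q ∋ e} = q · a_q`, every avoiding `q`-set having `q` elements and every through-`y` `(q+1)`-set `q` elements
besides `y`) it gives `q · a_q · b_p ≤ q · a_p · b_q`, i.e. (LR): **`biIndepLR_of_PE : BiIndepPE M → BiIndepLR M`**.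
CENSUS (night-1 g27, own exact integer code, dossier §39): every matroid on ≤ 8 elements (65,832 `(M, y, e)`
instances), every theta graph with ≤ 13 edges (20,354 instances, including Θ(1,2,3,3,4) where the `e`-restricted
(LR) of the minors' pairs FAILS) — 0 failures of (PE) in its consecutive and in its all-pairs form; the `n = 9`
figures are in the dossier. In the split of `RankLevelSetBiIndepLRSplit` the consecutive (PE) is `T1 + C21`: the
first minor's (LR) term plus the clean half of the cross term — it survives where `T1` alone is negative.
Nothing here asserts (PE) or (LR); every declaration has a docstring; imports: the cell's own modules and Mathlib only.
Axioms: standard. -/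

namespace PercRepro

open Set Matroid Finset

variable {α : Type} (M : Matroid α) [M.Finite]

omit [M.Finite] in
/-- `#{Q ∈ D_{k+1} : y ∈ Q, e ∈ Q}`: the bi-independent `(k+1)`-sets through `y` that contain `e`. -/
noncomputable def yThroughWithCount (y e : α) (k : ℕ) : ℕ := {Q ∈ biIndep M (k + 1) | y ∈ Q ∧ e ∈ Q}.ncard

omit [M.Finite] in
/-- `#{Z ∈ D_k : y ∉ Z, e ∈ Z}`: the bi-independent `k`-sets avoiding `y` that contain `e`. -/
noncomputable def yAvoidWithCount (y e : α) (k : ℕ) : ℕ := {Z ∈ biIndep M k | y ∉ Z ∧ e ∈ Z}.ncard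

omit [M.Finite] in
/-- **(PE), the per-element refinement of (LR)** (a `Prop`, NOT asserted): for every `y ∈ E`, every `e ∈ E` with
`e ≠ y` and all `p < q`, `#{Q ∈ D_{q+1} : y, e ∈ Q} · b_p ≤ a_p · #{Z ∈ D_q : y ∉ Z, e ∈ Z}`. -/
def BiIndepPE : Prop :=
  ∀ y ∈ M.E, ∀ e ∈ M.E, e ≠ y → ∀ p q : ℕ, p < q →
    yThroughWithCount M y e q * yAvoidCount M y p ≤ yThroughCount M y p * yAvoidWithCount M y e q

omit [M.Finite] in
/-- The `e`-refined through count is the incidence count of `e` on the through-`y` family. -/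
lemma yThroughWithCount_eq (y e : α) (k : ℕ) :
    yThroughWithCount M y e k = {Q ∈ {Q ∈ biIndep M (k + 1) | y ∈ Q} | e ∈ Q}.ncard := by
  unfold yThroughWithCount
  congr 1
  ext Q
  simp only [Set.mem_setOf_eq, and_assoc]

omit [M.Finite] in
/-- The `e`-refined avoid count is the incidence count of `e` on the avoid-`y` family. -/
lemma yAvoidWithCount_eq (y e : α) (k : ℕ) :
    yAvoidWithCount M y e k = {Z ∈ {Z ∈ biIndep M k | y ∉ Z} | e ∈ Z}.ncard := by
  unfold yAvoidWithCount
  congr 1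
  ext Z
  simp only [Set.mem_setOf_eq, and_assoc]

omit [M.Finite] in
/-- At `e = y` the refined avoid count vanishes. -/
lemma yAvoidWithCount_self (y : α) (k : ℕ) : yAvoidWithCount M y y k = 0 := by
  unfold yAvoidWithCount
  have hempty : {Z ∈ biIndep M k | y ∉ Z ∧ y ∈ Z} = (∅ : Set (Set α)) := by
    ext Z
    simp only [Set.mem_setOf_eq, Set.mem_empty_iff_false, iff_false, not_and]
    exact fun _ h h' => h h'
  rw [hempty, Set.ncard_empty]

omit [M.Finite] in
/-- At `e = y` the refined through count is the through count. -/
lemma yThroughWithCount_self (y : α) (k : ℕ) : yThroughWithCount M y y k = yThroughCount M y k := by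
  unfold yThroughWithCount yThroughCount
  congr 1
  ext Q
  simp only [Set.mem_setOf_eq, and_self]

/-- **Double counting the avoiding sets**: `Σ_{e ∈ E} #{Z ∈ D_k : y ∉ Z, e ∈ Z} = k · b_k`. -/
lemma sum_yAvoidWithCount (y : α) (k : ℕ) :
    ∑ e ∈ M.ground_finite.toFinset, yAvoidWithCount M y e k = k * yAvoidCount M y k := by
  have hfin : ({Z ∈ biIndep M k | y ∉ Z} : Set (Set α)).Finite :=
    (biIndep_finite M k).subset (fun Z hZ => hZ.1)
  simp_rw [yAvoidWithCount_eq]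
  rw [sum_ncard_filter_mem M _ hfin (fun Z hZ => hZ.1.1)]
  rw [Finset.sum_const_nat (m := k) (fun Z hZ => (hfin.mem_toFinset.mp hZ).1.2.1)]
  rw [mul_comm]
  unfold yAvoidCount
  rw [Set.ncard_eq_toFinset_card _ hfin]

/-- **Double counting the through sets**: `Σ_{e ∈ E} #{Q ∈ D_{k+1} : y ∈ Q, e ∈ Q} = (k + 1) · a_k`. -/
lemma sum_yThroughWithCount (y : α) (k : ℕ) :
    ∑ e ∈ M.ground_finite.toFinset, yThroughWithCount M y e k = (k + 1) * yThroughCount M y k := by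
  have hfin : ({Q ∈ biIndep M (k + 1) | y ∈ Q} : Set (Set α)).Finite :=
    (biIndep_finite M (k + 1)).subset (fun Q hQ => hQ.1)
  simp_rw [yThroughWithCount_eq]
  rw [sum_ncard_filter_mem M _ hfin (fun Q hQ => hQ.1.1)]
  rw [Finset.sum_const_nat (m := k + 1) (fun Q hQ => (hfin.mem_toFinset.mp hQ).1.2.1)]
  rw [mul_comm]
  unfold yThroughCount
  rw [Set.ncard_eq_toFinset_card _ hfin]

/-- **The sums over `e ≠ y`**: `Σ_{e ∈ E ∖ {y}} #{Z ∈ D_k : y ∉ Z, e ∈ Z} = k · b_k` (the `y`-term is `0`). -/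
lemma sum_erase_yAvoidWithCount [DecidableEq α] {y : α} (hy : y ∈ M.E) (k : ℕ) :
    ∑ e ∈ M.ground_finite.toFinset.erase y, yAvoidWithCount M y e k = k * yAvoidCount M y k := by
  have h := sum_yAvoidWithCount M y k
  rw [← Finset.add_sum_erase _ _ (M.ground_finite.mem_toFinset.mpr hy), yAvoidWithCount_self, zero_add] at h
  exact h

/-- **The sums over `e ≠ y`**: `Σ_{e ∈ E ∖ {y}} #{Q ∈ D_{k+1} : y ∈ Q, e ∈ Q} = k · a_k` (the `y`-term is `a_k`). -/
lemma sum_erase_yThroughWithCount [DecidableEq α] {y : α} (hy : y ∈ M.E) (k : ℕ) :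
    ∑ e ∈ M.ground_finite.toFinset.erase y, yThroughWithCount M y e k = k * yThroughCount M y k := by
  have h := sum_yThroughWithCount M y k
  rw [← Finset.add_sum_erase _ _ (M.ground_finite.mem_toFinset.mpr hy), yThroughWithCount_self, add_mul,
    one_mul] at h
  omega

/-- **(PE) IMPLIES (LR)**: summing the per-element inequality over `e ∈ E ∖ {y}` gives `q · a_q · b_p ≤ q · a_p · b_q`
for `p < q`, hence `a_q · b_p ≤ a_p · b_q`; `p = q` is trivial. -/
theorem biIndepLR_of_PE (h : BiIndepPE M) : BiIndepLR M := by
  classical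
  intro y hy p q hpq
  rcases Nat.eq_or_lt_of_le hpq with rfl | hlt
  · exact le_rfl
  have hsum : ∑ e ∈ M.ground_finite.toFinset.erase y, yThroughWithCount M y e q * yAvoidCount M y p ≤
      ∑ e ∈ M.ground_finite.toFinset.erase y, yThroughCount M y p * yAvoidWithCount M y e q := by
    refine Finset.sum_le_sum (fun e he => ?_)
    have he' := Finset.mem_erase.mp he
    exact h y hy e (M.ground_finite.mem_toFinset.mp he'.2) he'.1 p q hlt
  rw [← Finset.sum_mul, ← Finset.mul_sum, sum_erase_yThroughWithCount M hy q,
    sum_erase_yAvoidWithCount M hy q] at hsum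
  -- `q * a_q * b_p ≤ a_p * (q * b_q)`
  have hq : 0 < q := by omega
  have h1 : q * (yThroughCount M y q * yAvoidCount M y p) ≤ q * (yThroughCount M y p * yAvoidCount M y q) := by
    calc q * (yThroughCount M y q * yAvoidCount M y p)
        = q * yThroughCount M y q * yAvoidCount M y p := by ring
      _ ≤ yThroughCount M y p * (q * yAvoidCount M y q) := hsum
      _ = q * (yThroughCount M y p * yAvoidCount M y q) := by ring
  exact Nat.le_of_mul_le_mul_left h1 hq

/-- **(PE) implies (★★)** and hence the monotone profile. -/
theorem biIndepPerElem_of_PE (h : BiIndepPE M) : BiIndepPerElem M :=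
  biIndepPerElem_of_LR M (biIndepLR_of_PE M h)

omit [M.Finite] in
/-- **The consecutive form of (PE)** is the case `q = p + 1`. -/
lemma biIndepPE_step (h : BiIndepPE M) {y : α} (hy : y ∈ M.E) {e : α} (he : e ∈ M.E) (hey : e ≠ y) (p : ℕ) :
    yThroughWithCount M y e (p + 1) * yAvoidCount M y p ≤
      yThroughCount M y p * yAvoidWithCount M y e (p + 1) :=
  h y hy e he hey p (p + 1) (Nat.lt_succ_self p)

end PercRepro
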